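import Literature.NumberTheory.GaloisRepresentations.AbsGaloisGroup
import Mathlib.FieldTheory.Galois.Infinite
import Mathlib.FieldTheory.Normal.Basic
import HarnessLib

/-!
# A local model of a Galois layer: the absolute Galois group of an extension field acts on a normal subextension
# through the "decomposition group", onto it, and with fixed field the model (Cassels–Fröhlich VII §1.1; Neukirch II §8–§9)

Topic `NumberTheory/GaloisRepresentations`; namespace `Literature.NumberTheory.GaloisRepresentations.IdeleReadout`
(`galRestrictField`) and `….IdeleReadout.LocalModel` (the engine).  Definitions with bodies and theorems; NO named
fact, no `sorry`, no instance, no notation.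

The ENGINE behind the local readout of the presentation road (Route A of crux `AnticycControlAdditiveK`, item 19295;
door-c6 g16 FINDING §5 (R-def)/(R3)), written once for finite AND infinite places.  Data: a Galois extension `E/K`
with a `K`-embedding `ιE : E → K̄`; an extension field `Kv` of `K` (intended: a completion `K_v`) with the tree's chosen
`ι_v : K̄ → K̄_v` (`absClosureEmbedding`, restriction `absGaloisRestrict`); a "local model" `L` of `E` at `v` — a normal
extension of `Kv` with a ring map `j : E → L` (intended: `E ⊆ E_w`) — together with a `Kv`-embedding
`φ : L → K̄_v` extending `ι_v ∘ ιE` (`φ (j e) = ι_v (ιE e)`), and a subgroup `S ≤ Gal(E/K)` (intended: the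
decomposition group of `w`) with a BIJECTIVE `δ : S → Gal(L/Kv)` compatible with `j` (`δ s (j e) = j (s e)`).
Conclusions (all by finite Galois theory inside `K̄_v`, no topology):

* `galRestrictField Kv ιE : Γ_{Kv} →* Gal(E/K)` (restriction through `ι_v` and `ιE`), `ιE_galRestrictField`,
  `eq_galRestrictField`;
* **`LocalModel.galRestrictField_mem`**: `Γ_{Kv}` restricts INTO `S`; **`LocalModel.φ_δ_galRestrictField`**:
  `φ (δ(d|_E) y) = d • φ y` — `Γ_{Kv}` acts on the model through the decomposition group (proof: `y ↦ d • φ y`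
  restricts to an automorphism `τ` of the normal `L`, `τ = δ s`, and `s` agrees with `d|_E` on `E` because `φ ∘ j`
  is injective);
* **`LocalModel.exists_galRestrictField_eq`**: `Γ_{Kv} → S` is ONTO (lift `δ s` to `K̄_v` by `AlgEquiv.liftNormal`);
* **`LocalModel.smul_φ_of_galRestrictField_eq_one`** / **`LocalModel.exists_φ_eq_of_forall_smul`**: the kernel of the
  restriction fixes `φ(L)` pointwise, and conversely (characteristic `0`) an element of `K̄_v` fixed by the kernel lies in
  `φ(L)` (infinite Galois theory for `K̄_v/Kv`, Mathlib `InfiniteGalois.fixedField_fixingSubgroup`).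

Instances in the tree: finite `v` — `L = E_{w_v}`, `φ = SemiLocal.placeEmb`, `S = G_{w_v}`, `δ = SemiLocal.decompHom`
(door-c5 g17 `CompletionCompositumEmbedding`, where these facts were obtained from the compositum); infinite `v` — the
sequel `ArchCompletionEmbedding.lean` (`L = E_{w}`, `δ = ArchHerbrand.archDecompHom`).

## References
* J. W. S. Cassels, A. Fröhlich (eds.), *Algebraic Number Theory* (1967), Ch. VII (Tate) §1.1 ("`G_w` is the Galois
  group of `L_w/K_v`"), Prop. 1.2. [CasselsFrohlichANT1967]
* J. Neukirch, *Algebraic Number Theory* (1999), Ch. II (8.1)–(8.3), (9.1). [NeukirchANT1999]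
-/

noncomputable section

open Field

namespace Literature.NumberTheory.GaloisRepresentations

namespace IdeleReadout

universe u

section Restrict

variable {K : Type u} [Field K] (Kv : Type u) [Field Kv] [Algebra K Kv]
variable {E : Type u} [Field E] [Algebra K E] [Normal K E] (ιE : E →ₐ[K] AlgebraicClosure K)

/-- **The restriction `Γ_{Kv} → Gal(E/K)`, `d ↦ (d|_{K̄})|_E`** along the chosen `K̄ → K̄_v` and `ιE : E → K̄`
(`E/K` normal). [cite: CasselsFrohlichANT1967, Ch. VII §1.1] -/
def galRestrictField : absoluteGaloisGroup Kv →* (E ≃ₐ[K] E) :=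
  letI : Algebra E (AlgebraicClosure K) := ιE.toRingHom.toAlgebra
  haveI : IsScalarTower K E (AlgebraicClosure K) := IsScalarTower.of_algebraMap_eq fun x => (ιE.commutes x).symm
  (AlgEquiv.restrictNormalHom (F := K) (K₁ := AlgebraicClosure K) E).comp (absGaloisRestrict K Kv).toMonoidHom

/-- **`ιE (d|_E e) = d|_{K̄} • ιE e`.** [cite: CasselsFrohlichANT1967, Ch. VII §1.1] -/
theorem ιE_galRestrictField (d : absoluteGaloisGroup Kv) (e : E) :
    ιE (galRestrictField Kv ιE d e) = absGaloisRestrict K Kv d • ιE e := by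
  letI : Algebra E (AlgebraicClosure K) := ιE.toRingHom.toAlgebra
  haveI : IsScalarTower K E (AlgebraicClosure K) := IsScalarTower.of_algebraMap_eq fun x => (ιE.commutes x).symm
  exact AlgEquiv.restrictNormal_commutes (absGaloisRestrict K Kv d) E e

/-- In `K̄_v`: `ι_v (ιE (d|_E e)) = d • ι_v (ιE e)`. [cite: CasselsFrohlichANT1967, Ch. VII §1.1] -/
theorem absClosureEmbedding_ιE_galRestrictField (d : absoluteGaloisGroup Kv) (e : E) :
    absClosureEmbedding K Kv (ιE (galRestrictField Kv ιE d e)) = d • absClosureEmbedding K Kv (ιE e) := by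
  rw [ιE_galRestrictField, absGaloisRestrict_apply_smul]

/-- The restriction is characterised by `ιE (g e) = d|_{K̄} • ιE e`. [cite: CasselsFrohlichANT1967, Ch. VII §1.1] -/
theorem eq_galRestrictField {d : absoluteGaloisGroup Kv} {g : E ≃ₐ[K] E}
    (hg : ∀ e : E, ιE (g e) = absGaloisRestrict K Kv d • ιE e) : g = galRestrictField Kv ιE d :=
  AlgEquiv.ext fun e => ιE.injective ((hg e).trans (ιE_galRestrictField Kv ιE d e).symm)

/-- Variant in `K̄_v`: `ι_v (ιE (g e)) = d • ι_v (ιE e)` for all `e` forces `g = d|_E`. [cite: CasselsFrohlichANT1967, Ch. VII §1.1] -/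
theorem eq_galRestrictField_of_smul {d : absoluteGaloisGroup Kv} {g : E ≃ₐ[K] E}
    (hg : ∀ e : E, absClosureEmbedding K Kv (ιE (g e)) = d • absClosureEmbedding K Kv (ιE e)) :
    g = galRestrictField Kv ιE d :=
  eq_galRestrictField Kv ιE fun e => (absClosureEmbedding K Kv).injective
    ((hg e).trans (absGaloisRestrict_apply_smul K Kv d (ιE e)).symm)

end Restrict

/-! ## The engine -/

namespace LocalModel

variable {K : Type u} [Field K] {Kv : Type u} [Field Kv] [Algebra K Kv]
variable {E : Type u} [Field E] [Algebra K E] [Normal K E] {ιE : E →ₐ[K] AlgebraicClosure K}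
variable {L : Type u} [Field L] [Algebra Kv L] [Normal Kv L]
variable {j : E →+* L} {φ : L →ₐ[Kv] AlgebraicClosure Kv}
variable {S : Subgroup (E ≃ₐ[K] E)} {δ : S →* (L ≃ₐ[Kv] L)}

/-- The structure `L → K̄_v` given by `φ` (local, for the restriction machinery). [cite: CasselsFrohlichANT1967, Ch. VII §1.1] -/
abbrev algebraOfφ (φ : L →ₐ[Kv] AlgebraicClosure Kv) : Algebra L (AlgebraicClosure Kv) := φ.toRingHom.toAlgebra

omit [Normal Kv L] in
/-- `Kv → L → K̄_v` is a scalar tower for `algebraOfφ`. [cite: CasselsFrohlichANT1967, Ch. VII §1.1] -/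
theorem isScalarTower_algebraOfφ (φ : L →ₐ[Kv] AlgebraicClosure Kv) :
    letI := algebraOfφ φ; IsScalarTower Kv L (AlgebraicClosure Kv) :=
  letI := algebraOfφ φ
  IsScalarTower.of_algebraMap_eq fun x => (φ.commutes x).symm

/-- **The automorphism `τ_d` of the model induced by `d ∈ Γ_{Kv}`**: the restriction to the normal `L` of
`y ↦ d • φ y` (`φ (τ_d y) = d • φ y`). [cite: CasselsFrohlichANT1967, Ch. VII §1.1] -/
def tau (φ : L →ₐ[Kv] AlgebraicClosure Kv) (d : absoluteGaloisGroup Kv) : L ≃ₐ[Kv] L :=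
  letI := algebraOfφ φ
  haveI := isScalarTower_algebraOfφ φ
  (((absoluteGaloisGroup.toAlgEquiv Kv d : AlgebraicClosure Kv ≃ₐ[Kv] AlgebraicClosure Kv) :
    AlgebraicClosure Kv →ₐ[Kv] AlgebraicClosure Kv).comp φ).restrictNormal' L

/-- **`φ (τ_d y) = d • φ y`.** [cite: CasselsFrohlichANT1967, Ch. VII §1.1] -/
theorem φ_tau (φ : L →ₐ[Kv] AlgebraicClosure Kv) (d : absoluteGaloisGroup Kv) (y : L) :
    φ (tau φ d y) = d • φ y := by
  letI := algebraOfφ φ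
  haveI := isScalarTower_algebraOfφ φ
  have h := AlgHom.restrictNormal_commutes
    (((absoluteGaloisGroup.toAlgEquiv Kv d : AlgebraicClosure Kv ≃ₐ[Kv] AlgebraicClosure Kv) :
      AlgebraicClosure Kv →ₐ[Kv] AlgebraicClosure Kv).comp φ) L y
  rw [Algebra.algebraMap_self, RingHom.id_apply] at h
  exact h

section WithHyps

variable (hφ : ∀ e : E, φ (j e) = absClosureEmbedding K Kv (ιE e))
  (hδ : Function.Bijective δ) (hδj : ∀ (s : S) (e : E), δ s (j e) = j ((s : E ≃ₐ[K] E) e))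
include hφ hδ hδj

/-- The element of `S` with `δ s = τ_d` agrees with `d|_E` (as elements of `Gal(E/K)`).
[cite: CasselsFrohlichANT1967, Ch. VII §1.1] -/
theorem coe_symm_tau_eq (d : absoluteGaloisGroup Kv) :
    (((MulEquiv.ofBijective δ hδ).symm (tau φ d) : S) : E ≃ₐ[K] E) = galRestrictField Kv ιE d := by
  set s := (MulEquiv.ofBijective δ hδ).symm (tau φ d) with hs
  have hds : δ s = tau φ d := (MulEquiv.ofBijective δ hδ).apply_symm_apply (tau φ d)
  refine eq_galRestrictField_of_smul Kv ιE fun e => ?_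
  rw [← hφ, ← hφ, ← hδj, hds, φ_tau]

/-- **`Γ_{Kv}` restricts into the decomposition group `S`.** [cite: CasselsFrohlichANT1967, Ch. VII §1.1, Prop. 1.2] -/
theorem galRestrictField_mem (d : absoluteGaloisGroup Kv) : galRestrictField Kv ιE d ∈ S := by
  rw [← coe_symm_tau_eq hφ hδ hδj d]
  exact Subtype.coe_prop _

/-- `δ (d|_E) = τ_d`. [cite: CasselsFrohlichANT1967, Ch. VII §1.1] -/
theorem δ_galRestrictField (d : absoluteGaloisGroup Kv) :
    δ ⟨galRestrictField Kv ιE d, galRestrictField_mem hφ hδ hδj d⟩ = tau φ d := by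
  have h : (⟨galRestrictField Kv ιE d, galRestrictField_mem hφ hδ hδj d⟩ : S) =
      (MulEquiv.ofBijective δ hδ).symm (tau φ d) := Subtype.ext (coe_symm_tau_eq hφ hδ hδj d).symm
  rw [h]
  exact (MulEquiv.ofBijective δ hδ).apply_symm_apply (tau φ d)

/-- **Equivariance: `φ (δ(d|_E) y) = d • φ y`** — `Γ_{Kv}` acts on the model `φ(L) ⊆ K̄_v` through the decomposition
group. [cite: CasselsFrohlichANT1967, Ch. VII §1.1] -/
theorem φ_δ_galRestrictField (d : absoluteGaloisGroup Kv) (y : L) :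
    φ (δ ⟨galRestrictField Kv ιE d, galRestrictField_mem hφ hδ hδj d⟩ y) = d • φ y := by
  rw [δ_galRestrictField hφ hδ hδj, φ_tau]

/-- The same for any membership proof. [cite: CasselsFrohlichANT1967, Ch. VII §1.1] -/
theorem φ_δ_apply_of_coe_eq {s : S} {d : absoluteGaloisGroup Kv} (hs : (s : E ≃ₐ[K] E) = galRestrictField Kv ιE d)
    (y : L) : φ (δ s y) = d • φ y := by
  have h : s = ⟨galRestrictField Kv ιE d, galRestrictField_mem hφ hδ hδj d⟩ := Subtype.ext hs
  rw [h, φ_δ_galRestrictField hφ hδ hδj]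

omit [Normal Kv L] hδ in
/-- **`Γ_{Kv} → S` is onto**: every `s ∈ S` is `d|_E` for some `d` (lift `δ s` to an automorphism of the normal `K̄_v`).
[cite: CasselsFrohlichANT1967, Ch. VII §1.1, Prop. 1.2] -/
theorem exists_galRestrictField_eq (s : S) : ∃ d : absoluteGaloisGroup Kv, galRestrictField Kv ιE d = s := by
  letI := algebraOfφ φ
  haveI := isScalarTower_algebraOfφ φ
  let dAlg : AlgebraicClosure Kv ≃ₐ[Kv] AlgebraicClosure Kv := (δ s).liftNormal (AlgebraicClosure Kv)
  refine ⟨(absoluteGaloisGroup.toAlgEquiv Kv).symm dAlg, (eq_galRestrictField_of_smul Kv ιE fun e => ?_).symm⟩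
  rw [absoluteGaloisGroup.toAlgEquiv_symm_apply, ← hφ, ← hφ, ← hδj]
  exact ((δ s).liftNormal_commutes (AlgebraicClosure Kv) (j e)).symm

/-- **The kernel of the restriction fixes `φ(L)` pointwise.** [cite: CasselsFrohlichANT1967, Ch. VII §1.1] -/
theorem smul_φ_of_galRestrictField_eq_one {d : absoluteGaloisGroup Kv} (hd : galRestrictField Kv ιE d = 1) (y : L) :
    d • φ y = φ y := by
  rw [← φ_δ_galRestrictField hφ hδ hδj d y]
  have h1 : (⟨galRestrictField Kv ιE d, galRestrictField_mem hφ hδ hδj d⟩ : S) = 1 := Subtype.ext hd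
  rw [h1, map_one, AlgEquiv.one_apply]

omit [Normal Kv L] hδ hδj in
/-- **Conversely (characteristic `0`): an element of `K̄_v` fixed by the kernel of the restriction lies in `φ(L)`**
(the kernel contains `Gal(K̄_v/φ(L))`, whose fixed field is `φ(L)` — infinite Galois theory).
[cite: CasselsFrohlichANT1967, Ch. VII §1.1] [cite: NeukirchANT1999, Ch. II (9.1)] -/
theorem exists_φ_eq_of_forall_smul [CharZero Kv] {x : AlgebraicClosure Kv}
    (hx : ∀ d : absoluteGaloisGroup Kv, galRestrictField Kv ιE d = 1 → d • x = x) : ∃ y : L, φ y = x := by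
  have hfix : ∀ d ∈ φ.fieldRange.fixingSubgroup, d x = x := fun d hd => by
    rw [IntermediateField.mem_fixingSubgroup_iff] at hd
    have h := hx ((absoluteGaloisGroup.toAlgEquiv Kv).symm d) ?_
    · rwa [absoluteGaloisGroup.toAlgEquiv_symm_apply] at h
    · refine (eq_galRestrictField_of_smul Kv ιE (g := 1) fun e => ?_).symm
      rw [AlgEquiv.one_apply, absoluteGaloisGroup.toAlgEquiv_symm_apply, ← hφ]
      exact (hd _ ⟨j e, rfl⟩).symm
  have hmem : x ∈ IntermediateField.fixedField φ.fieldRange.fixingSubgroup := fun d => hfix d d.2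
  rw [InfiniteGalois.fixedField_fixingSubgroup] at hmem
  obtain ⟨y, hy⟩ := hmem
  exact ⟨y, hy⟩

end WithHyps

end LocalModel

end IdeleReadout

end Literature.NumberTheory.GaloisRepresentations

end
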